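import Summits.QuantumFields.BalabanUV.T4Continuum.Support.G183FreePartSubordination

/-!
# G183FreePartProducts — part 3/5 of the proof of `G183KernelRates.FreePartRate`: elementary real inequalities for the
# time integrals (§5: `(1+u)^p e^{−u/c} ≤ c^p p! e^{1/c}`, the Gaussian small-time factor `gaussFactor_le`, the mass/Gaussian
# trade `exp_half_mul_gauss_le`) and the pointwise bounds on the product kernels `P_l(t,y) = Π_ν l·q_{2l²t}(y_ν)` (§6: small
# times, large times, and the TELESCOPED two-level difference `abs_levelProd_sub_le` with the rate `n^{−2}`)

Cell `pub-balaban`, T4-DAG §5 node U1a, spine estimate NE2, prover P2, lineage t4-ne2-p2 gen 8, row T4-U1a.E-NE2-PROVE-P2h*.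
HONEST FRAMING: rung (B)+1 bookkeeping for the LINEAR theory at `U = 1` on the infinite fine lattices `(1/n)ℤ^{d+1}`; NOT the
torus, NOT `U ≠ 1`, NOT infinite-volume physics, NOT a mass gap, NOT Clay.  Inputs: Mathlib and kernel-proved tree theorems BY
NAME (`Literature.Probability.LatticeModels.*` after Lawler–Limic 2010 [LawlerLimic2010]; `G183KernelRates` gen 7); nothing
printed in the audited papers is a hypothesis; no `def … : Prop` is assumed; no `sorry`.  All namespace
`Summit.QuantumFields.BalabanUV.T4Continuum.G183FreePartRate` (one proof split over five ≤ 400-line files: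
`G183FreePartOneDim` §1–§2 → `G183FreePartSubordination` §3–§4 → `G183FreePartProducts` §5–§6 → `G183FreePartPieces` §7 →
`G183FreePartRate` §8 = the theorem and the full header: statement, proof outline, reading, sources).
-/

noncomputable section

open MeasureTheory Set Filter Real
open scoped Real Topology BigOperators

namespace Summit.QuantumFields.BalabanUV.T4Continuum.G183FreePartRate

open Literature.Probability.LatticeModels

/-! ## §5 Elementary real inequalities for the time integrals -/

/-- `(1+u)^p e^{−u/c} ≤ c^p p! e^{1/c}` for `u ≥ 0`, `c > 0`. [folklore] -/
theorem one_add_pow_mul_exp_neg_div_le (p : ℕ) {c : ℝ} (hc : 0 < c) {u : ℝ} (hu : 0 ≤ u) :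
    (1 + u) ^ p * Real.exp (-(u / c)) ≤ c ^ p * p.factorial * Real.exp (1 / c) := by
  have hy : 0 ≤ (1 + u) / c := by positivity
  have h := Real.pow_div_factorial_le_exp (hx := hy) (n := p)
  have hf : (0 : ℝ) < p.factorial := by exact_mod_cast Nat.factorial_pos p
  rw [div_le_iff₀ hf] at h
  have e1 : (1 + u) ^ p = c ^ p * ((1 + u) / c) ^ p := by
    rw [← mul_pow]; congr 1; field_simp
  have e2 : Real.exp ((1 + u) / c) = Real.exp (1 / c) * Real.exp (u / c) := by
    rw [← Real.exp_add]; congr 1; ring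
  have e3 : Real.exp (u / c) * Real.exp (-(u / c)) = 1 := by rw [← Real.exp_add]; simp
  rw [e1]
  calc c ^ p * ((1 + u) / c) ^ p * Real.exp (-(u / c))
      ≤ c ^ p * (Real.exp ((1 + u) / c) * p.factorial) * Real.exp (-(u / c)) := by gcongr
    _ = c ^ p * p.factorial * Real.exp (1 / c) * (Real.exp (u / c) * Real.exp (-(u / c))) := by rw [e2]; ring
    _ = c ^ p * p.factorial * Real.exp (1 / c) := by rw [e3, mul_one]

/-- `u^p e^{−u/c} ≤ c^p p!` for `u ≥ 0`, `c > 0`. [folklore] -/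
theorem pow_mul_exp_neg_div_le (p : ℕ) {c : ℝ} (hc : 0 < c) {u : ℝ} (hu : 0 ≤ u) :
    u ^ p * Real.exp (-(u / c)) ≤ c ^ p * p.factorial := by
  have hy : 0 ≤ u / c := by positivity
  have h := Real.pow_div_factorial_le_exp (hx := hy) (n := p)
  have hf : (0 : ℝ) < p.factorial := by exact_mod_cast Nat.factorial_pos p
  rw [div_le_iff₀ hf] at h
  have e1 : u ^ p = c ^ p * (u / c) ^ p := by rw [← mul_pow]; congr 1; field_simp
  have e3 : Real.exp (u / c) * Real.exp (-(u / c)) = 1 := by rw [← Real.exp_add]; simp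
  rw [e1]
  calc c ^ p * (u / c) ^ p * Real.exp (-(u / c))
      ≤ c ^ p * (Real.exp (u / c) * p.factorial) * Real.exp (-(u / c)) := by gcongr
    _ = c ^ p * p.factorial * (Real.exp (u / c) * Real.exp (-(u / c))) := by ring
    _ = c ^ p * p.factorial := by rw [e3, mul_one]

/-- the Gaussian small-time factor: `(2t)^{−D/2} e^{−ρ²/(32t)} ≤ 16^D D! e^{1/16} ρ^{−D}` for `t, ρ > 0`. [folklore] -/
theorem gaussFactor_le (D : ℕ) {t ρ : ℝ} (ht : 0 < t) (hρ : 0 < ρ) :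
    (2 * t) ^ (-((D : ℝ) / 2)) * Real.exp (-(ρ ^ 2 / (32 * t))) ≤
      (16 ^ D * D.factorial * Real.exp (1 / 16)) * (ρ ^ D)⁻¹ := by
  set y : ℝ := ρ ^ 2 / (32 * t) with hy
  have hy0 : 0 < y := by positivity
  have hD0 : (0 : ℝ) ≤ (D : ℝ) / 2 := by positivity
  -- `(2t)^{-D/2} = (16y)^{D/2} / ρ^D`
  have e1 : (2 * t) ^ (-((D : ℝ) / 2)) = (16 * y) ^ ((D : ℝ) / 2) * (ρ ^ D)⁻¹ := by
    have h2t : 2 * t = ρ ^ 2 / (16 * y) := by rw [hy]; field_simp; ring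
    rw [Real.rpow_neg (by positivity), h2t, Real.div_rpow (by positivity) (by positivity),
      show (ρ ^ 2 : ℝ) = ρ ^ (2 : ℝ) by norm_cast, ← Real.rpow_mul hρ.le,
      show (2 : ℝ) * ((D : ℝ) / 2) = (D : ℕ) by ring, Real.rpow_natCast, inv_div, div_eq_mul_inv]
  -- `(16y)^{D/2} ≤ (1 + 16y)^D`
  have e2 : (16 * y) ^ ((D : ℝ) / 2) ≤ (1 + 16 * y) ^ D := by
    calc (16 * y) ^ ((D : ℝ) / 2) ≤ (1 + 16 * y) ^ ((D : ℝ) / 2) :=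
          Real.rpow_le_rpow (by positivity) (by linarith) hD0
      _ ≤ (1 + 16 * y) ^ (D : ℝ) :=
          Real.rpow_le_rpow_of_exponent_le (by linarith) (by linarith [Nat.cast_nonneg (α := ℝ) D])
      _ = (1 + 16 * y) ^ D := Real.rpow_natCast _ _
  have e3 : (1 + 16 * y) ^ D * Real.exp (-y) ≤ 16 ^ D * D.factorial * Real.exp (1 / 16) := by
    have h := one_add_pow_mul_exp_neg_div_le D (by norm_num : (0:ℝ) < 16) (by positivity : 0 ≤ 16 * y)
    rwa [show -(16 * y / 16) = -y by ring] at h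
  rw [e1]
  calc (16 * y) ^ ((D : ℝ) / 2) * (ρ ^ D)⁻¹ * Real.exp (-y)
      = (16 * y) ^ ((D : ℝ) / 2) * Real.exp (-y) * (ρ ^ D)⁻¹ := by ring
    _ ≤ (1 + 16 * y) ^ D * Real.exp (-y) * (ρ ^ D)⁻¹ := by gcongr
    _ ≤ _ := mul_le_mul_of_nonneg_right e3 (by positivity)

/-- trading half of the Gaussian against the mass: `e^{−t/2} e^{−ρ²/(32t)} ≤ e^{−ρ/8} e^{−ρ²/(64t)}` (`t > 0`). [folklore] -/
theorem exp_half_mul_gauss_le {t : ℝ} (ht : 0 < t) (ρ : ℝ) :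
    Real.exp (-(1 / 2) * t) * Real.exp (-(ρ ^ 2 / (32 * t))) ≤
      Real.exp (-(ρ / 8)) * Real.exp (-(ρ ^ 2 / (64 * t))) := by
  rw [← Real.exp_add, ← Real.exp_add]
  refine Real.exp_le_exp.2 ?_
  have key : 0 ≤ (1 / 2 * t + ρ ^ 2 / (64 * t)) - ρ / 8 := by
    have e : (1 / 2 * t + ρ ^ 2 / (64 * t)) - ρ / 8 = (16 * t ^ 2 + (4 * t - ρ) ^ 2) / (64 * t) := by
      field_simp; ring
    rw [e]; positivity
  have e2 : ρ ^ 2 / (32 * t) = ρ ^ 2 / (64 * t) + ρ ^ 2 / (64 * t) := by field_simp; ring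
  rw [e2]
  linarith

/-! ## §6 Pointwise bounds on the product kernels -/

section Products

variable {d : ℕ}

/-- SMALL times `2l²t ≤ 1`: `|P_l(t,y)| ≤ (l e^{7/8})^{d+1} e^{−|y_{i₀}|}` for any coordinate `i₀`. [folklore] -/
theorem abs_levelProd_le_small {l : ℕ} (hl : 1 ≤ l) {t : ℝ} (ht0 : 0 ≤ t) (ht : 2 * (l : ℝ) ^ 2 * t ≤ 1)
    (y : Fin (d + 1) → ℤ) (i₀ : Fin (d + 1)) :
    |levelProd (d := d) l t y| ≤ ((l : ℝ) * Real.exp (7 / 8)) ^ (d + 1) * Real.exp (-((|y i₀| : ℤ) : ℝ)) := by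
  unfold levelProd
  rw [Finset.abs_prod]
  have hfac : ∀ i, |(l : ℝ) * srwHeatKernel (2 * (l : ℝ) ^ 2 * t) (y i)| ≤
      (l : ℝ) * Real.exp (7 / 8) * Real.exp (-((|y i| : ℤ) : ℝ)) := by
    intro i
    have h := abs_levelKer_le_small hl ht0 ht (y i)
    have e : ((|y i| : ℤ) : ℝ) = |((y i : ℤ) : ℝ)| := by push_cast; rfl
    rw [e]; linarith [h]
  calc ∏ i, |(l : ℝ) * srwHeatKernel (2 * (l : ℝ) ^ 2 * t) (y i)|
      ≤ ∏ i, ((l : ℝ) * Real.exp (7 / 8) * Real.exp (-((|y i| : ℤ) : ℝ))) :=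
        Finset.prod_le_prod (fun i _ => abs_nonneg _) fun i _ => hfac i
    _ = ((l : ℝ) * Real.exp (7 / 8)) ^ (d + 1) * Real.exp (-(∑ i, ((|y i| : ℤ) : ℝ))) := by
        rw [Finset.prod_mul_distrib, Finset.prod_const, Finset.card_univ, Fintype.card_fin, ← Real.exp_sum,
          Finset.sum_neg_distrib]
    _ ≤ _ := by
        gcongr
        exact Finset.single_le_sum (f := fun i => ((|y i| : ℤ) : ℝ)) (fun i _ => by positivity)
          (Finset.mem_univ i₀)

/-- `((2t)^{-1/2})^{k} = (2t)^{-k/2}`. [folklore] -/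
theorem rpow_half_pow {t : ℝ} (ht : 0 < t) (k : ℕ) :
    ((2 * t) ^ (-(1 / 2 : ℝ))) ^ k = (2 * t) ^ (-((k : ℝ) / 2)) := by
  rw [← Real.rpow_mul_natCast (by positivity : (0:ℝ) ≤ 2 * t)]
  congr 1; ring

/-- LARGE times `2l²t ≥ 1`: `|P_l(t,y)| ≤ 2^d (2t)^{−(d+1)/2}(e^{−(y_{i₀}/l)²/(16t)} + e^{−|y_{i₀}|/8})`. [folklore] -/
theorem abs_levelProd_le_large {l : ℕ} (hl : 1 ≤ l) {t : ℝ} (ht : 1 ≤ 2 * (l : ℝ) ^ 2 * t)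
    (y : Fin (d + 1) → ℤ) (i₀ : Fin (d + 1)) :
    |levelProd (d := d) l t y| ≤ 2 ^ d * (2 * t) ^ (-(((d : ℝ) + 1) / 2)) *
        (Real.exp (-((((y i₀ : ℤ) : ℝ) / l) ^ 2 / (16 * t))) + Real.exp (-((|((y i₀ : ℤ) : ℝ)|) / 8))) := by
  classical
  have ht0 : 0 < t := pos_of_one_le_level ht
  have hT : 0 < (2 * t) ^ (-(1 / 2 : ℝ)) := Real.rpow_pos_of_pos (by positivity) _
  set ω : Fin (d + 1) → ℝ := fun i =>
    Real.exp (-((((y i : ℤ) : ℝ) / l) ^ 2 / (16 * t))) + Real.exp (-((|((y i : ℤ) : ℝ)|) / 8)) with hω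
  have hω2 : ∀ i, ω i ≤ 2 := fun i => by
    simp only [hω]
    have h1 : Real.exp (-((((y i : ℤ) : ℝ) / l) ^ 2 / (16 * t))) ≤ 1 :=
      Real.exp_le_one_iff.2 (by rw [neg_nonpos]; positivity)
    have h2 : Real.exp (-((|((y i : ℤ) : ℝ)|) / 8)) ≤ 1 := Real.exp_le_one_iff.2 (by rw [neg_nonpos]; positivity)
    linarith
  have hfac : ∀ i, |(l : ℝ) * srwHeatKernel (2 * (l : ℝ) ^ 2 * t) (y i)| ≤ (2 * t) ^ (-(1 / 2 : ℝ)) * ω i := by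
    intro i
    have h := abs_levelKer_le hl ht (y i)
    simp only [hω]; exact h
  unfold levelProd
  rw [Finset.abs_prod, ← Finset.mul_prod_erase _ _ (Finset.mem_univ i₀)]
  have hrest : ∏ i ∈ Finset.univ.erase i₀, |(l : ℝ) * srwHeatKernel (2 * (l : ℝ) ^ 2 * t) (y i)| ≤
      ∏ _i ∈ Finset.univ.erase i₀, (2 * (2 * t) ^ (-(1 / 2 : ℝ))) := by
    refine Finset.prod_le_prod (fun i _ => abs_nonneg _) fun i _ => (hfac i).trans ?_
    exact (mul_le_mul_of_nonneg_left (hω2 i) hT.le).trans_eq (mul_comm _ _)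
  rw [Finset.prod_const, Finset.card_erase_of_mem (Finset.mem_univ i₀), Finset.card_univ, Fintype.card_fin,
    Nat.add_sub_cancel] at hrest
  calc |(l : ℝ) * srwHeatKernel (2 * (l : ℝ) ^ 2 * t) (y i₀)| *
        ∏ i ∈ Finset.univ.erase i₀, |(l : ℝ) * srwHeatKernel (2 * (l : ℝ) ^ 2 * t) (y i)|
      ≤ ((2 * t) ^ (-(1 / 2 : ℝ)) * ω i₀) * (2 * (2 * t) ^ (-(1 / 2 : ℝ))) ^ d :=
        mul_le_mul (hfac i₀) hrest (Finset.prod_nonneg fun i _ => abs_nonneg _) (by positivity)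
    _ = 2 ^ d * ((2 * t) ^ (-(1 / 2 : ℝ))) ^ (d + 1) * ω i₀ := by rw [mul_pow]; ring
    _ = _ := by rw [rpow_half_pow ht0 (d + 1), Nat.cast_succ]

open Literature.MathematicalPhysics.QuantumFieldTheory.Balaban1983to89 in
/-- **THE TELESCOPED DIFFERENCE** at large times `2n²t ≥ 1`, levels `n ≤ m`, a fine point `x` of level `n` and its copy
`x′` at level `m` (`x′·n = x·m`): `|P_m(t,x′) − P_n(t,x)| ≤ (d+1)·2C₂·2^d · n^{−2}(2t)^{−(d+3)/2}(e^{−(x_{i₀}/n)²/(32t)} +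
e^{−|x_{i₀}|/16})` — every factor within `(C₂/l²)(2t)^{−3/2}(…)` of the COMMON level-free Gaussian `Φ_t(x_{i}/n)`.
[folklore] -/
theorem abs_levelProd_sub_le {n m : ℕ} (hn : 1 ≤ n) (hnm : n ≤ m) {t : ℝ} (ht : 1 ≤ 2 * (n : ℝ) ^ 2 * t)
    (x x' : Fin (d + 1) → ℤ) (hx' : ∀ i, x' i * n = x i * m) (i₀ : Fin (d + 1)) :
    |levelProd (d := d) m t x' - levelProd (d := d) n t x| ≤
      ((d : ℝ) + 1) * (2 * C2) * 2 ^ d * ((n : ℝ) ^ 2)⁻¹ * (2 * t) ^ (-(((d : ℝ) + 3) / 2)) *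
        (Real.exp (-((((x i₀ : ℤ) : ℝ) / n) ^ 2 / (32 * t))) + Real.exp (-((|((x i₀ : ℤ) : ℝ)|) / 16))) := by
  classical
  have hm : 1 ≤ m := hn.trans hnm
  have hn0 : (0 : ℝ) < n := by exact_mod_cast hn
  have hm0 : (0 : ℝ) < m := by exact_mod_cast hm
  have hnm' : (n : ℝ) ≤ m := by exact_mod_cast hnm
  have ht0 : 0 < t := pos_of_one_le_level ht
  have htm : 1 ≤ 2 * (m : ℝ) ^ 2 * t := by nlinarith [mul_le_mul hnm' hnm' hn0.le hm0.le]
  have hT : 0 < (2 * t) ^ (-(1 / 2 : ℝ)) := Real.rpow_pos_of_pos (by positivity) _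
  have hT3 : 0 < (2 * t) ^ (-(3 / 2 : ℝ)) := Real.rpow_pos_of_pos (by positivity) _
  -- physical coordinates agree, lattice coordinates grow
  have hρ : ∀ i, ((x' i : ℤ) : ℝ) / m = ((x i : ℤ) : ℝ) / n := by
    intro i
    have h : ((x' i : ℤ) : ℝ) * n = ((x i : ℤ) : ℝ) * m := by exact_mod_cast hx' i
    field_simp; linarith [h]
  have habs : ∀ i, |((x i : ℤ) : ℝ)| ≤ |((x' i : ℤ) : ℝ)| := by
    intro i
    have h : ((x' i : ℤ) : ℝ) * n = ((x i : ℤ) : ℝ) * m := by exact_mod_cast hx' i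
    have h1 : |((x' i : ℤ) : ℝ)| * n = |((x i : ℤ) : ℝ)| * m := by
      rw [← abs_of_pos hn0, ← abs_of_pos hm0, ← abs_mul, ← abs_mul, h]
    nlinarith [abs_nonneg ((x i : ℤ) : ℝ), abs_nonneg ((x' i : ℤ) : ℝ)]
  set ω : Fin (d + 1) → ℝ := fun i =>
    Real.exp (-((((x i : ℤ) : ℝ) / n) ^ 2 / (32 * t))) + Real.exp (-((|((x i : ℤ) : ℝ)|) / 16)) with hω
  have hω0 : ∀ i, 0 ≤ ω i := fun i => by positivity
  have hω2 : ∀ i, ω i ≤ 2 := fun i => by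
    simp only [hω]
    have h1 : Real.exp (-((((x i : ℤ) : ℝ) / n) ^ 2 / (32 * t))) ≤ 1 :=
      Real.exp_le_one_iff.2 (by rw [neg_nonpos]; positivity)
    have h2 : Real.exp (-((|((x i : ℤ) : ℝ)|) / 16)) ≤ 1 := Real.exp_le_one_iff.2 (by rw [neg_nonpos]; positivity)
    linarith
  -- the Chernoff weights of both levels are below `ω`
  have hωn : ∀ i, Real.exp (-((((x i : ℤ) : ℝ) / n) ^ 2 / (16 * t))) + Real.exp (-((|((x i : ℤ) : ℝ)|) / 8)) ≤ ω i := by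
    intro i; simp only [hω]
    refine add_le_add (Real.exp_le_exp.2 ?_) (Real.exp_le_exp.2 ?_)
    · have : 0 ≤ (((x i : ℤ) : ℝ) / n) ^ 2 / (32 * t) := by positivity
      rw [show (((x i : ℤ) : ℝ) / n) ^ 2 / (16 * t) = 2 * ((((x i : ℤ) : ℝ) / n) ^ 2 / (32 * t)) by field_simp; ring]
      linarith
    · linarith [abs_nonneg ((x i : ℤ) : ℝ)]
  have hωm : ∀ i, Real.exp (-((((x' i : ℤ) : ℝ) / m) ^ 2 / (16 * t))) + Real.exp (-((|((x' i : ℤ) : ℝ)|) / 8)) ≤ ω i := by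
    intro i
    have hP : Real.exp (-((|((x' i : ℤ) : ℝ)|) / 8)) ≤ Real.exp (-((|((x i : ℤ) : ℝ)|) / 8)) :=
      Real.exp_le_exp.2 (by linarith [habs i])
    refine le_trans (add_le_add le_rfl hP) ?_
    rw [hρ i]; exact hωn i
  have hωm' : ∀ i, Real.exp (-((((x i : ℤ) : ℝ) / n) ^ 2 / (32 * t))) + Real.exp (-((|((x' i : ℤ) : ℝ)|) / 16)) ≤ ω i := by
    intro i
    have hP : Real.exp (-((|((x' i : ℤ) : ℝ)|) / 16)) ≤ Real.exp (-((|((x i : ℤ) : ℝ)|) / 16)) :=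
      Real.exp_le_exp.2 (by linarith [habs i])
    simp only [hω]
    exact add_le_add le_rfl hP
  -- the three hypotheses of the telescoping bound
  set a : Fin (d + 1) → ℝ := fun i => (2 * t) ^ (-(1 / 2 : ℝ)) * ω i with ha
  set δ : Fin (d + 1) → ℝ := fun i => 2 * C2 * ((n : ℝ) ^ 2)⁻¹ * (2 * t) ^ (-(3 / 2 : ℝ)) * ω i with hδ
  have cast_abs : ∀ z : ℤ, (|z| : ℝ) = |((z : ℤ) : ℝ)| := fun z => rfl
  have hf : ∀ i ∈ (Finset.univ : Finset (Fin (d + 1))),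
      |(m : ℝ) * srwHeatKernel (2 * (m : ℝ) ^ 2 * t) (x' i)| ≤ a i := by
    intro i _
    have h := abs_levelKer_le hm htm (x' i)
    rw [cast_abs] at h
    exact h.trans (mul_le_mul_of_nonneg_left (hωm i) hT.le)
  have hg : ∀ i ∈ (Finset.univ : Finset (Fin (d + 1))),
      |(n : ℝ) * srwHeatKernel (2 * (n : ℝ) ^ 2 * t) (x i)| ≤ a i := by
    intro i _
    have h := abs_levelKer_le hn ht (x i)
    rw [cast_abs] at h
    exact h.trans (mul_le_mul_of_nonneg_left (hωn i) hT.le)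
  have hδi : ∀ i ∈ (Finset.univ : Finset (Fin (d + 1))),
      |(m : ℝ) * srwHeatKernel (2 * (m : ℝ) ^ 2 * t) (x' i) - (n : ℝ) * srwHeatKernel (2 * (n : ℝ) ^ 2 * t) (x i)|
        ≤ δ i := by
    intro i _
    have h1 := abs_levelKer_sub_Phi_le hm htm (x' i)
    have h2 := abs_levelKer_sub_Phi_le hn ht (x i)
    rw [cast_abs] at h1 h2
    rw [hρ i] at h1
    have hmn2 : C2 / (m : ℝ) ^ 2 ≤ C2 / (n : ℝ) ^ 2 :=
      div_le_div_of_nonneg_left C2_pos.le (by positivity) (pow_le_pow_left₀ hn0.le hnm' 2)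
    have hCn : 0 ≤ C2 / (n : ℝ) ^ 2 * (2 * t) ^ (-(3 / 2 : ℝ)) :=
      mul_nonneg (div_nonneg C2_pos.le (by positivity)) hT3.le
    have h1' : |(m : ℝ) * srwHeatKernel (2 * (m : ℝ) ^ 2 * t) (x' i) - Phi t (((x i : ℤ) : ℝ) / n)| ≤
        C2 / (n : ℝ) ^ 2 * (2 * t) ^ (-(3 / 2 : ℝ)) * ω i :=
      h1.trans (mul_le_mul (mul_le_mul_of_nonneg_right hmn2 hT3.le) (hωm' i) (by positivity) hCn)
    have h2' : |(n : ℝ) * srwHeatKernel (2 * (n : ℝ) ^ 2 * t) (x i) - Phi t (((x i : ℤ) : ℝ) / n)| ≤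
        C2 / (n : ℝ) ^ 2 * (2 * t) ^ (-(3 / 2 : ℝ)) * ω i :=
      h2.trans (mul_le_mul_of_nonneg_left (by simp only [hω]; exact le_rfl) hCn)
    calc |(m : ℝ) * srwHeatKernel (2 * (m : ℝ) ^ 2 * t) (x' i) - (n : ℝ) * srwHeatKernel (2 * (n : ℝ) ^ 2 * t) (x i)|
        ≤ |(m : ℝ) * srwHeatKernel (2 * (m : ℝ) ^ 2 * t) (x' i) - Phi t (((x i : ℤ) : ℝ) / n)| +
          |(n : ℝ) * srwHeatKernel (2 * (n : ℝ) ^ 2 * t) (x i) - Phi t (((x i : ℤ) : ℝ) / n)| := by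
          rw [abs_sub_comm ((n : ℝ) * _)]; exact abs_sub_le _ _ _
      _ ≤ C2 / (n : ℝ) ^ 2 * (2 * t) ^ (-(3 / 2 : ℝ)) * ω i + C2 / (n : ℝ) ^ 2 * (2 * t) ^ (-(3 / 2 : ℝ)) * ω i :=
          add_le_add h1' h2'
      _ = δ i := by simp only [hδ]; rw [div_eq_mul_inv]; ring
  have htel := abs_prod_sub_prod_le Finset.univ (fun i => (m : ℝ) * srwHeatKernel (2 * (m : ℝ) ^ 2 * t) (x' i))
    (fun i => (n : ℝ) * srwHeatKernel (2 * (n : ℝ) ^ 2 * t) (x i)) a δ hf hg hδi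
  have hterm : ∀ j ∈ (Finset.univ : Finset (Fin (d + 1))), δ j * ∏ i ∈ Finset.univ.erase j, a i =
      2 * C2 * ((n : ℝ) ^ 2)⁻¹ * (2 * t) ^ (-(3 / 2 : ℝ)) * ((2 * t) ^ (-(1 / 2 : ℝ))) ^ d * ∏ i, ω i := by
    intro j _
    rw [ha, Finset.prod_mul_distrib, Finset.prod_const, Finset.card_erase_of_mem (Finset.mem_univ j),
      Finset.card_univ, Fintype.card_fin, Nat.add_sub_cancel, ← Finset.mul_prod_erase Finset.univ ω (Finset.mem_univ j),
      hδ]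
    ring
  rw [Finset.sum_congr rfl hterm, Finset.sum_const, Finset.card_univ, Fintype.card_fin, nsmul_eq_mul] at htel
  -- `∏ ω ≤ 2^d ω_{i₀}`
  have hprodω : ∏ i, ω i ≤ 2 ^ d * ω i₀ := by
    rw [← Finset.mul_prod_erase _ _ (Finset.mem_univ i₀)]
    have h : ∏ i ∈ Finset.univ.erase i₀, ω i ≤ ∏ _i ∈ Finset.univ.erase i₀, (2 : ℝ) :=
      Finset.prod_le_prod (fun i _ => hω0 i) fun i _ => hω2 i
    rw [Finset.prod_const, Finset.card_erase_of_mem (Finset.mem_univ i₀), Finset.card_univ, Fintype.card_fin,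
      Nat.add_sub_cancel] at h
    rw [mul_comm]
    exact mul_le_mul_of_nonneg_right h (hω0 i₀)
  -- powers of `2t`
  have htpow : (2 * t) ^ (-(3 / 2 : ℝ)) * ((2 * t) ^ (-(1 / 2 : ℝ))) ^ d = (2 * t) ^ (-(((d : ℝ) + 3) / 2)) := by
    rw [rpow_half_pow ht0 d, ← Real.rpow_add (by positivity)]
    congr 1; ring
  have hpos : 0 ≤ ((d + 1 : ℕ) : ℝ) * (2 * C2 * ((n : ℝ) ^ 2)⁻¹ * (2 * t) ^ (-(3 / 2 : ℝ)) *
      ((2 * t) ^ (-(1 / 2 : ℝ))) ^ d) := by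
    have := C2_pos; positivity
  unfold levelProd
  calc |∏ i, (m : ℝ) * srwHeatKernel (2 * (m : ℝ) ^ 2 * t) (x' i) - ∏ i, (n : ℝ) * srwHeatKernel (2 * (n : ℝ) ^ 2 * t) (x i)|
      ≤ ((d + 1 : ℕ) : ℝ) * (2 * C2 * ((n : ℝ) ^ 2)⁻¹ * (2 * t) ^ (-(3 / 2 : ℝ)) *
          ((2 * t) ^ (-(1 / 2 : ℝ))) ^ d * ∏ i, ω i) := htel
    _ = ((d + 1 : ℕ) : ℝ) * (2 * C2 * ((n : ℝ) ^ 2)⁻¹ * (2 * t) ^ (-(3 / 2 : ℝ)) *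
          ((2 * t) ^ (-(1 / 2 : ℝ))) ^ d) * ∏ i, ω i := by ring
    _ ≤ ((d + 1 : ℕ) : ℝ) * (2 * C2 * ((n : ℝ) ^ 2)⁻¹ * (2 * t) ^ (-(3 / 2 : ℝ)) *
          ((2 * t) ^ (-(1 / 2 : ℝ))) ^ d) * (2 ^ d * ω i₀) := mul_le_mul_of_nonneg_left hprodω hpos
    _ = ((d : ℝ) + 1) * (2 * C2) * 2 ^ d * ((n : ℝ) ^ 2)⁻¹ *
          ((2 * t) ^ (-(3 / 2 : ℝ)) * ((2 * t) ^ (-(1 / 2 : ℝ))) ^ d) * ω i₀ := by push_cast; ring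
    _ = _ := by rw [htpow]

end Products

end Summit.QuantumFields.BalabanUV.T4Continuum.G183FreePartRate
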